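import Mathlib
import HarnessLib
import Literature.Computability.AlgebraicComplexity.PatternExpressions
import Summits.ValiantsHypothesis.ValiantsHypothesis.Theorems.MonotoneRestorationMonotoneRestorationQPLinearWidthDefs
import Summits.ValiantsHypothesis.ValiantsHypothesis.Theorems.MonotoneRestorationMonotoneRestorationQPLinearWidthKroneckerMonotonicity
import Summits.ValiantsHypothesis.ValiantsHypothesis.Theorems.MonotoneRestorationOrbitRestorationQPPerNotNarrow

/-!
# Route MonotoneRestoration, crux `MonotoneRestorationQP` (stmt-15886), line `linear_width` —
# KRONECKER-ISOLABLE DETERMINED EXPANSIONS ARE NARROW, HENCE RESTORABLE (conditional sublinear rung, weighted currency)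

Helper file (`--supports stmt-ValiantsHypothesis-15886`), def-free.  Composition of the weighted monotonicity theorem
`KroneckerMonotonicity.eval_homPoly_eq_of_determined_of_coeff_ne_zero` (every pattern of volume `≤ m` a side in a
`HomIndist (m·ν) k`-determined expansion is `HomIndist ν k`-determined) with the tree's K2/K3 engine
`OrbitRestorationQPHomPolyClose.qpOrbit_of_mem_narrowSpan` (narrow span ⇒ square-symmetric circuits of quasi-polynomial orbit size):

* `mem_narrowSpan_of_determined_of_distinguishable` — ONE LEVEL: if `p = Σ_i α_i hom_{F_i,N}` (pairwise non-isomorphic,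
  isolated-vertex-free patterns with `≤ m` vertices a side, `Fin N ≃ Fin m × Fin ν`) is determined by `HomIndist N k`, and
  every `F_i` of treewidth `≥ k` is DISTINGUISHED at level `ν` (two points of `ℂ^{ν×ν}`, hom-indistinguishable below
  treewidth `k`, at which `hom_{F_i,ν}` differs — the weighted, bipartite, non-uniform homomorphism-distinguishing
  closedness of treewidth `< k` at level `ν`, Dawar–Pago–Seppelt 2025 §7.1.1, an INPUT here), then `p` lies in the span of
  the `hom_{F,N}` with `tw F < k`: DETERMINED ⇒ NARROW for Kronecker-isolable expansions, with NO loss of width;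
* `qpOrbit_of_determined_of_isolable` — THE FAMILY FORM: a family `f` determined at width `(log₂ n + c)^c` at every
  level (the node `PolylogHomDetermined` of the line, unfolded) which at every level `N` admits such an expansion along
  some factorisation `Fin N ≃ Fin m × Fin ν` whose wide patterns are distinguished at level `ν`, has square-symmetric
  circuits of orbit size `≤ 2^((log₂ N + c + 3)^(c+3))` — `VP`, matrix symmetry and degree idle.

So (Q1) "determined ⇒ narrow" (`…LinearWidthQ1Bridge/Q1Calibration/CuspTest.lean`), false in general at equal width
from `n = 8` (evidence Q1-PROBE.md), HOLDS at equal width on the sub-class of expansions whose patterns have volume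
`≤ N/ν` for a level `ν` at which treewidth `≥ k` is detected; the rung's residue in this currency is the complementary
class — patterns (components) of volume `> N/ν` for every admissible `ν` (census KRONECKER-MONOTONICITY-g11.md).
Honest label: composition of landed pieces + the in-print isolation step; the distinguishability input is a hypothesis,
not a tree theorem; no stub closed; the rung, the cruxes and VP ≠ VNP NOT moved.
[cite: DawarPagoSeppelt2025, Thm 7.9, Thm 7.11, §7.1.1; DwivediPagoSeppelt2026, Lemma 8.18]
-/

set_option linter.dupNamespace false

noncomputable section

open scoped Classical

namespace Summit.ValiantsHypothesis.ValiantsHypothesis.Theorems.KroneckerMonotonicity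

open MvPolynomial Literature.Computability.AlgebraicComplexity
open Summit.ValiantsHypothesis.ValiantsHypothesis.Theorems.MonotoneRestorationQPLinearWidth

/-- **DETERMINED ⇒ NARROW for Kronecker-isolable expansions (one level, no loss of width).**
[cite: DawarPagoSeppelt2025, Thm 7.11 (Claim 3) and §7.1.1] -/
theorem mem_narrowSpan_of_determined_of_distinguishable {N m ν k M : ℕ} (e : Fin N ≃ Fin m × Fin ν)
    (a b : Fin M → ℕ) (E : (i : Fin M) → Multiset (Fin (a i) × Fin (b i))) (α : Fin M → ℂ)
    (hle : ∀ i, a i ≤ m ∧ b i ≤ m)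
    (hrow : ∀ i (u : Fin (a i)), ∃ x ∈ E i, x.1 = u)
    (hcol : ∀ i (v : Fin (b i)), ∃ x ∈ E i, x.2 = v)
    (hiso : ∀ i j, i ≠ j → ∀ (ea : Fin (a i) ≃ Fin (a j)) (eb : Fin (b i) ≃ Fin (b j)),
      ((E i).map fun x => (ea x.1, eb x.2)) ≠ E j)
    (hdet : ∀ A B : Fin N × Fin N → ℂ, HomIndist N k A B →
      eval A (∑ i, C (α i) * homPoly (E i) N ℂ) = eval B (∑ i, C (α i) * homPoly (E i) N ℂ))
    (hdist : ∀ i, k ≤ Literature.Combinatorics.SimpleGraph.treewidth (patternGraph (E i)) →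
      ∃ z z' : Fin ν × Fin ν → ℂ, HomIndist ν k z z' ∧ eval z (homPoly (E i) ν ℂ) ≠ eval z' (homPoly (E i) ν ℂ)) :
    (∑ i, C (α i) * homPoly (E i) N ℂ) ∈ Submodule.span ℂ
      {q : MvPolynomial (Fin N × Fin N) ℂ | ∃ (a b : ℕ) (E : Multiset (Fin a × Fin b)),
        Literature.Combinatorics.SimpleGraph.treewidth
            (SimpleGraph.fromRel fun u v : Fin a ⊕ Fin b => ∃ e ∈ E, u = Sum.inl e.1 ∧ v = Sum.inr e.2) < k ∧
          q = homPoly E N ℂ} := by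
  refine Submodule.sum_mem _ fun i _ => ?_
  by_cases hi : α i = 0
  · rw [hi, C_0, zero_mul]
    exact Submodule.zero_mem _
  · have htw : Literature.Combinatorics.SimpleGraph.treewidth (patternGraph (E i)) < k := by
      by_contra hge
      obtain ⟨z, z', hzz, hne⟩ := hdist i (not_lt.1 hge)
      exact hne (eval_homPoly_eq_of_determined_of_coeff_ne_zero e a b E α hle hrow hcol hiso hdet hi hzz)
    have hmem : homPoly (E i) N ℂ ∈ Submodule.span ℂ
        {q : MvPolynomial (Fin N × Fin N) ℂ | ∃ (a b : ℕ) (E : Multiset (Fin a × Fin b)),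
          Literature.Combinatorics.SimpleGraph.treewidth
              (SimpleGraph.fromRel fun u v : Fin a ⊕ Fin b => ∃ e ∈ E, u = Sum.inl e.1 ∧ v = Sum.inr e.2) < k ∧
            q = homPoly E N ℂ} :=
      Submodule.subset_span ⟨a i, b i, E i, htw, rfl⟩
    rw [← smul_eq_C_mul]
    exact Submodule.smul_mem _ _ hmem

/-- **THE FAMILY FORM — a conditional rung in weighted currency.**  A family determined at width `(log₂ n + c)^c` at
every level which admits, at every level `N`, a Kronecker-isolable expansion (`Fin N ≃ Fin m × Fin ν`, patterns pairwise
non-isomorphic, isolated-vertex-free, `≤ m` vertices a side) whose patterns of treewidth `≥ (log₂ N + c)^c` are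
distinguished at level `ν`, has square-symmetric circuits of orbit size `≤ 2^((log₂ N + c + 3)^(c+3))` (K2/K3,
`qpOrbit_of_mem_narrowSpan`).  No `VP`, symmetry or degree hypothesis. [cite: DawarPagoSeppelt2025, Thm 7.9; DawarWilsenach2025, §3.3] -/
theorem qpOrbit_of_determined_of_isolable (f : (n : ℕ) → MvPolynomial (Fin n × Fin n) ℂ) (c : ℕ)
    (hf : ∀ (n : ℕ) (A B : Fin n × Fin n → ℂ), HomIndist n ((Nat.log 2 n + c) ^ c) A B →
      eval A (f n) = eval B (f n))
    (hexp : ∀ N : ℕ, ∃ (m ν M : ℕ) (_ : Fin N ≃ Fin m × Fin ν) (a b : Fin M → ℕ)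
      (E : (i : Fin M) → Multiset (Fin (a i) × Fin (b i))) (α : Fin M → ℂ),
      (∀ i, a i ≤ m ∧ b i ≤ m) ∧ (∀ i (u : Fin (a i)), ∃ x ∈ E i, x.1 = u) ∧
      (∀ i (v : Fin (b i)), ∃ x ∈ E i, x.2 = v) ∧
      (∀ i j, i ≠ j → ∀ (ea : Fin (a i) ≃ Fin (a j)) (eb : Fin (b i) ≃ Fin (b j)),
        ((E i).map fun x => (ea x.1, eb x.2)) ≠ E j) ∧
      f N = ∑ i, C (α i) * homPoly (E i) N ℂ ∧
      ∀ i, (Nat.log 2 N + c) ^ c ≤ Literature.Combinatorics.SimpleGraph.treewidth (patternGraph (E i)) →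
        ∃ z z' : Fin ν × Fin ν → ℂ, HomIndist ν ((Nat.log 2 N + c) ^ c) z z' ∧
          eval z (homPoly (E i) ν ℂ) ≠ eval z' (homPoly (E i) ν ℂ))
    (N : ℕ) :
    ∃ (G : Type) (_ : Fintype G) (C : LabelledArithCircuit ℂ (Fin N × Fin N) Unit G),
      C.IsSymmetric (Equiv.Perm (Fin N)) ∧ C.eval (C.output ()) = f N ∧
        C.orbitSize (Equiv.Perm (Fin N)) ≤ 2 ^ ((Nat.log 2 N + (c + 3)) ^ (c + 3)) := by
  refine OrbitRestorationQPHomPolyClose.qpOrbit_of_mem_narrowSpan f c (fun n => ?_) N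
  obtain ⟨m, ν, M, e, a, b, E, α, hle, hrow, hcol, hiso, hfe, hdist⟩ := hexp n
  have hdet : ∀ A B : Fin n × Fin n → ℂ, HomIndist n ((Nat.log 2 n + c) ^ c) A B →
      eval A (∑ i, C (α i) * homPoly (E i) n ℂ) = eval B (∑ i, C (α i) * homPoly (E i) n ℂ) := by
    intro A B hAB
    rw [← hfe]
    exact hf n A B hAB
  have hmem := mem_narrowSpan_of_determined_of_distinguishable e a b E α hle hrow hcol hiso hdet hdist
  rw [hfe]
  refine Submodule.span_mono ?_ hmem
  rintro q ⟨a', b', E', htw, rfl⟩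
  exact ⟨a', b', E', htw.le, rfl⟩

end Summit.ValiantsHypothesis.ValiantsHypothesis.Theorems.KroneckerMonotonicity

end
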